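import Literature.NumberTheory.EllipticCurves.NewformsMainLemmaTraceProofs
import HarnessLib
/-!
# One-prime trace identities `Tr ∘ B_d` on `Γ₀` (route `EdixhovenFibreFiveSeven`, crux TDS57, `--supports`;
# ROAD A′ = Ihara-free L-TWIST, part 2)

Cell `pub/bsd-wall` (D-0145 line `route-BirchSwinnertonDyer-EdixhovenFibreFiveSeven`), seat `bsd-line-edix-p3`
(prover). Route-free file: THEOREMS ONLY (no definition, no named fact, no `sorry`). BSD is not proved by this file.

For `q` prime, `q ∤ M`, write `Tr¹ = Tr^{Mq}_M`, `Tr² = Tr^{Mq²}_{Mq}` (`restrictLevel`) and `B_d = [diag(d,1)]_k`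
(`degeneracyMap0`, `(B_d f)(τ) = d^{k−1} f(dτ)`). We prove the compositions of traces with degeneracy maps
(Shimura 1971 Prop. 3.38 `[XY]_k = [X]_k [Y]_k`; Li 1975 Lemma 1–5; Atkin–Lehner 1970 §2):

* `restrictLevel_toLevel0_of_not_dvd`: `Tr¹ f = (q+1) f` for `f` of level `M`;
* `restrictLevel_degeneracyMap0_eq_heckeT`: `Tr¹ (B_q f) = T_q f` for `f` of level `M`
  (from the tree's `T_q F = Tr¹(F ∣ W_q) − F ∣ W_q`, `coe_heckeT_eq_sub`);
* `coe_restrictLevel_degeneracyMap0_mul_level`: `Tr² (B_q G) = B_q (Tr¹ G) − G ∣ W_q` for `G` of level `Mq`;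
* hence, at level `M q²` and in the normalisation of the double twist identity
  (`LTwist.charTwist_charTwist_eq`): `Tr¹ Tr² B₁ = q(q+1)`, `Tr¹ Tr² B_q = q T_q`,
  `Tr¹ Tr² B_{q²} = T_q² − q^{k−2}(q+1)` on `S_k(Γ₀(M))` (`restrictLevel_restrictLevel_degeneracyMap0_one/_self/_sq`).

References: [Shimura1971] §3.4 Prop. 3.38, §7.2; [Li1975] §2 Lemma 1–5; [AtkinLehner1970] §2;
[DiamondShurman2005] §5.1 p. 166, §5.7.
-/

set_option autoImplicit false
-- the Theorems directory repeats the summit name (sibling precedent `SignedBaseChangeAssembly.lean`)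
set_option linter.dupNamespace false

noncomputable section

open scoped MatrixGroups ModularForm

open CongruenceSubgroup UpperHalfPlane Matrix.SpecialLinearGroup ModularGroup

namespace Summit.BirchSwinnertonDyer.BirchSwinnertonDyer.Theorems.LTwistTransfer

open Literature.NumberTheory.EllipticCurves.ModularForms

variable (k : ℤ) {q : ℕ} [NeZero q] [Fact q.Prime] {M : ℕ} [NeZero M]

/-! ### §1 `Tr^{Mq}_M` on level-`M` forms and on `B_q f` -/

omit [NeZero M] in
/-- `β ∈ Γ₀(M)` for `β = (x y; M ·)`. [folklore] -/
theorem beta_mem {β : SL(2, ℤ)} (hβ10 : β 1 0 = M) : β ∈ Gamma0 M := by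
  rw [Gamma0_mem, hβ10]; simp

/-- **`Tr^{Mq}_M f = (q + 1) f` for `f` of level `M`**, `q ∤ M` prime: all `q + 1` representatives
`(1 0; Mj 1)`, `β` of `Γ₀(Mq)\Γ₀(M)` lie in `Γ₀(M)` (Diamond–Shurman §5.1 p. 166 (3); the index
`[Γ₀(M) : Γ₀(Mq)] = q + 1`). [cite: DiamondShurman2005, §5.1 p. 166 case (3)] -/
theorem restrictLevel_toLevel0_of_not_dvd (hqM : ¬ q ∣ M) (f : CuspForm (Gamma0 M) k) :
    restrictLevel (Gamma0 (M * q)) (Gamma0 M) k (toLevel0 (dvd_mul_right M q) k f) =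
      ((q : ℂ) + 1) • f := by
  obtain ⟨β, hβ10, hβ11⟩ := exists_beta q M hqM
  apply DFunLike.coe_injective
  rw [coe_restrictLevel_gamma0_beta k q M (M * q) rfl β hβ10 hβ11, coe_toLevel0, CuspForm.IsGLPos.coe_smul]
  have hβ : (⇑f : ℍ → ℂ) ∣[k] (mapGL ℝ β : GL (Fin 2) ℝ) = ⇑f :=
    SlashInvariantFormClass.slash_action_eq f _ (Subgroup.mem_map_of_mem _ (beta_mem hβ10))
  have hLU : ∀ j : Fin q, (⇑f : ℍ → ℂ) ∣[k] (mapGL ℝ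
      (transpose (ModularGroup.T ^ ((M : ℤ) * ((j : ℕ) : ℤ)))) : GL (Fin 2) ℝ) = ⇑f := fun j ↦
    SlashInvariantFormClass.slash_action_eq f _
      (Subgroup.mem_map_of_mem _ (LU_mem_gamma0 M (dvd_mul_right _ _)))
  simp only [hβ, hLU, Finset.sum_const, Finset.card_univ, Fintype.card_fin]
  rw [← Nat.cast_smul_eq_nsmul ℂ, add_smul, one_smul, add_comm]

/-- **`Tr^{Mq}_M (B_q f) = T_q f` for `f` of level `M`**, `q ∤ M` prime: by the tree's
`T_q F = Tr^{Mq}_M(F ∣ W_q) − F ∣ W_q` at level `Mq` (`coe_heckeT_eq_sub`) applied to `F = f`, where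
`f ∣ W_q = f ∣ diag(q,1) = B_q f` and `T_q^{(Mq)} f + B_q f = ∑ⱼ f ∣ (1 j; 0 q) + f ∣ diag(q,1) = T_q^{(M)} f`
(`coe_heckeT_gamma0_eq_sum` at both levels); i.e. the `q + 1` matrices `diag(q,1)·rᵢ` represent
`Γ₀(M) diag(1,q) Γ₀(M)` (Shimura 1971 Prop. 3.38). [cite: Shimura1971, §3.4 Prop. 3.38] -/
theorem restrictLevel_degeneracyMap0_eq_heckeT (hqM : ¬ q ∣ M) (f : CuspForm (Gamma0 M) k) :
    restrictLevel (Gamma0 (M * q)) (Gamma0 M) k (degeneracyMap0 M (M * q) q k f) =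
      heckeT (Gamma0 M) k q f := by
  have hq : q.Prime := Fact.out
  obtain ⟨β, hβ10, hβ11⟩ := exists_beta q M hqM
  set F : CuspForm (Gamma0 (M * q)) k := toLevel0 (dvd_mul_right M q) k f with hFdef
  -- `F ∣ W_q = B_q f` as cusp forms of level `Mq`
  have hW : cuspFormOfLE (gamma0_le_conj_beta_tpD (rfl : M * q = M * q) hβ10 hβ11)
      (CuspForm.translate F ((mapGL ℝ β : GL (Fin 2) ℝ) * tpD q)) = degeneracyMap0 M (M * q) q k f := by
    apply DFunLike.coe_injective
    rw [coe_cuspFormOfLE_translate_W k rfl hβ10 hβ11, hFdef, coe_toLevel0, coe_degeneracyMap0 (h := dvd_rfl),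
      SlashAction.slash_mul, SlashInvariantFormClass.slash_action_eq f _
        (Subgroup.mem_map_of_mem _ (beta_mem hβ10))]
  apply DFunLike.coe_injective
  have h1 := coe_heckeT_eq_sub k q (rfl : M * q = M * q) hβ10 hβ11 hqM F
  rw [hW] at h1
  have h2 : (⇑F : ℍ → ℂ) ∣[k] ((mapGL ℝ β : GL (Fin 2) ℝ) * tpD q) = ⇑f ∣[k] tpD q := by
    rw [hFdef, coe_toLevel0, SlashAction.slash_mul, SlashInvariantFormClass.slash_action_eq f _
      (Subgroup.mem_map_of_mem _ (beta_mem hβ10))]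
  rw [h2] at h1
  have h3 : (⇑(restrictLevel (Gamma0 (M * q)) (Gamma0 M) k (degeneracyMap0 M (M * q) q k f)) : ℍ → ℂ) =
      ⇑(heckeT (Gamma0 (M * q)) k q F) + ⇑f ∣[k] tpD q := by rw [h1]; abel
  rw [h3, coe_heckeT_gamma0_eq_sum (M * q) k q hq F, coe_heckeT_gamma0_eq_sum M k q hq f,
    if_pos (dvd_mul_left q M), if_neg hqM, add_zero, hFdef, coe_toLevel0]

/-! ### §2 `Tr^{Mq²}_{Mq} (B_q G) = B_q (Tr^{Mq}_M G) − G ∣ W_q` -/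

/-- **`Tr^{Mq²}_{Mq} (B_q G) = B_q (Tr^{Mq}_M G) − G ∣ W_q`** (as functions on `ℍ`) for `G` of level `Mq`,
`q ∤ M` prime, `W_q = β diag(q,1)`: the representatives `(1 0; Mq·j 1)` of `Γ₀(Mq²)\Γ₀(Mq)` satisfy
`diag(q,1)(1 0; Mqj 1) = (1 0; Mj 1) diag(q,1)`, and `{(1 0; Mj 1)} = {reps of Γ₀(Mq)\Γ₀(M)} ∖ {β}`
(Atkin–Lehner 1970 §2; Li 1975 Lemma 2). [cite: Li1975, §2 Lemma 2] -/
theorem coe_restrictLevel_degeneracyMap0_mul_level (hqM : ¬ q ∣ M) {β : SL(2, ℤ)} (hβ10 : β 1 0 = M)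
    (hβ11 : (q : ℤ) ∣ β 1 1) (G : CuspForm (Gamma0 (M * q)) k) :
    (⇑(restrictLevel (Gamma0 (M * q ^ 2)) (Gamma0 (M * q)) k (degeneracyMap0 (M * q) (M * q ^ 2) q k G)) :
        ℍ → ℂ) =
      ⇑(degeneracyMap0 M (M * q) q k (restrictLevel (Gamma0 (M * q)) (Gamma0 M) k G)) -
        ⇑G ∣[k] ((mapGL ℝ β : GL (Fin 2) ℝ) * tpD q) := by
  have _ := hqM
  have hL : M * q ^ 2 = M * q * q := by ring
  rw [coe_restrictLevel_gamma0_mul k q (M * q) (M * q ^ 2) hL (dvd_mul_left q M),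
    coe_degeneracyMap0 (h := (by rw [← hL] : M * q * q ∣ M * q ^ 2)), coe_degeneracyMap0 (h := dvd_rfl),
    coe_restrictLevel_gamma0_beta k q M (M * q) rfl β hβ10 hβ11 G]
  have hcomm : ∀ j : Fin q, ((⇑G : ℍ → ℂ) ∣[k] tpD q) ∣[k]
      (mapGL ℝ (transpose (ModularGroup.T ^ (((M * q : ℕ) : ℤ) * ((j : ℕ) : ℤ)))) : GL (Fin 2) ℝ) =
      ((⇑G : ℍ → ℂ) ∣[k] (mapGL ℝ (transpose (ModularGroup.T ^ ((M : ℤ) * ((j : ℕ) : ℤ)))) : GL (Fin 2) ℝ))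
        ∣[k] tpD q := by
    intro j
    rw [← SlashAction.slash_mul, ← SlashAction.slash_mul,
      show (((M * q : ℕ) : ℤ) * ((j : ℕ) : ℤ)) = (q : ℤ) * ((M : ℤ) * ((j : ℕ) : ℤ)) by push_cast; ring,
      tpD_mul_mapGL_LU]
  simp only [hcomm, ← SlashAction.sum_slash]
  rw [SlashAction.slash_mul, SlashAction.add_slash, add_sub_cancel_left]

omit [NeZero M] in
/-- For `f` of level `M` (`q ∤ M`, `W_q = β diag(q,1)`): `(B_q f) ∣ W_q = q^{k−2} f`, since
`f ∣ W_q = B_q f` and `W_q² = γ₀ · (q·1)`, `γ₀ ∈ Γ₀(Mq)` (tree `slash_W_slash_W`). [folklore] -/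
theorem slash_tpD_slash_W {β : SL(2, ℤ)} (hβ10 : β 1 0 = M) (hβ11 : (q : ℤ) ∣ β 1 1)
    (f : CuspForm (Gamma0 M) k) :
    ((⇑f : ℍ → ℂ) ∣[k] tpD q) ∣[k] ((mapGL ℝ β : GL (Fin 2) ℝ) * tpD q) = ((q : ℂ) ^ (k - 2)) • ⇑f := by
  have h := slash_W_slash_W k (rfl : M * q = M * q) hβ10 hβ11 (toLevel0 (dvd_mul_right M q) k f)
  have h0 : (⇑f : ℍ → ℂ) ∣[k] ((mapGL ℝ β : GL (Fin 2) ℝ) * tpD q) = ⇑f ∣[k] tpD q := by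
    rw [SlashAction.slash_mul, SlashInvariantFormClass.slash_action_eq f _
      (Subgroup.mem_map_of_mem _ (beta_mem hβ10))]
  rw [coe_toLevel0, h0] at h
  exact h

/-! ### §3 The double traces `Tr^{Mq}_M Tr^{Mq²}_{Mq} B_d`, `d = 1, q, q²` -/

/-- `diag(1,1) = 1`. [folklore] -/
theorem tpD_one : tpD 1 = (1 : GL (Fin 2) ℝ) := by
  refine Units.ext ?_
  rw [val_tpD]
  ext i j
  fin_cases i <;> fin_cases j <;> simp

omit [Fact q.Prime] in
/-- `diag(q,1)² = diag(q²,1)`. [folklore] -/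
theorem tpD_mul_tpD : tpD q * tpD q = tpD (q ^ 2) := by
  refine Units.ext ?_
  rw [Matrix.GeneralLinearGroup.coe_mul, val_tpD, val_tpD]
  ext i j
  fin_cases i <;> fin_cases j <;> simp [Matrix.mul_apply, Fin.sum_univ_two, sq]

omit [Fact q.Prime] in
/-- `B₁ : S_k(Γ₀(M)) → S_k(Γ₀(Mq²))` is the level change through `Mq`. [folklore] -/
theorem degeneracyMap0_one_eq_toLevel0 (f : CuspForm (Gamma0 M) k) :
    degeneracyMap0 M (M * q ^ 2) 1 k f =
      toLevel0 (⟨q, by ring⟩ : M * q ∣ M * q ^ 2) k (toLevel0 (dvd_mul_right M q) k f) := by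
  apply DFunLike.coe_injective
  rw [coe_degeneracyMap0 (h := ⟨q ^ 2, by ring⟩), coe_toLevel0, coe_toLevel0, tpD_one, SlashAction.slash_one]

omit [Fact q.Prime] in
/-- `B_q : S_k(Γ₀(M)) → S_k(Γ₀(Mq²))` is `B_q : S_k(Γ₀(M)) → S_k(Γ₀(Mq))` followed by the level change. [folklore] -/
theorem degeneracyMap0_eq_toLevel0_degeneracyMap0 (f : CuspForm (Gamma0 M) k) :
    degeneracyMap0 M (M * q ^ 2) q k f =
      toLevel0 (⟨q, by ring⟩ : M * q ∣ M * q ^ 2) k (degeneracyMap0 M (M * q) q k f) := by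
  apply DFunLike.coe_injective
  rw [coe_degeneracyMap0 (h := ⟨q, by ring⟩), coe_toLevel0, coe_degeneracyMap0 (h := dvd_rfl)]

omit [Fact q.Prime] in
/-- `B_{q²} = B_q ∘ B_q : S_k(Γ₀(M)) → S_k(Γ₀(Mq)) → S_k(Γ₀(Mq²))`. [folklore] -/
theorem degeneracyMap0_sq_eq (f : CuspForm (Gamma0 M) k) :
    degeneracyMap0 M (M * q ^ 2) (q ^ 2) k f =
      degeneracyMap0 (M * q) (M * q ^ 2) q k (degeneracyMap0 M (M * q) q k f) := by
  apply DFunLike.coe_injective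
  rw [coe_degeneracyMap0 (h := dvd_rfl), coe_degeneracyMap0 (h := ⟨1, by ring⟩),
    coe_degeneracyMap0 (h := dvd_rfl), ← SlashAction.slash_mul, tpD_mul_tpD]

/-- **`Tr^{Mq²}_{Mq} (B_q B_q f) = B_q (T_q f) − q^{k−2} f`** for `f` of level `M`, `q ∤ M` prime.
[cite: Li1975, §2 Lemma 2] -/
theorem restrictLevel_degeneracyMap0_degeneracyMap0 (hqM : ¬ q ∣ M) (f : CuspForm (Gamma0 M) k) :
    restrictLevel (Gamma0 (M * q ^ 2)) (Gamma0 (M * q)) k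
        (degeneracyMap0 (M * q) (M * q ^ 2) q k (degeneracyMap0 M (M * q) q k f)) =
      degeneracyMap0 M (M * q) q k (heckeT (Gamma0 M) k q f) -
        ((q : ℂ) ^ (k - 2)) • toLevel0 (dvd_mul_right M q) k f := by
  obtain ⟨β, hβ10, hβ11⟩ := exists_beta q M hqM
  apply DFunLike.coe_injective
  rw [coe_restrictLevel_degeneracyMap0_mul_level k hqM hβ10 hβ11, restrictLevel_degeneracyMap0_eq_heckeT k hqM,
    CuspForm.coe_sub, CuspForm.IsGLPos.coe_smul, coe_toLevel0]
  simp only [coe_degeneracyMap0 (h := (dvd_rfl : M * q ∣ M * q))]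
  rw [slash_tpD_slash_W k hβ10 hβ11]

/-- **`Tr^{Mq}_M Tr^{Mq²}_{Mq} B₁ = q(q+1)`** on `S_k(Γ₀(M))` (`q ∤ M` prime): the degree of `X₀(Mq²) → X₀(M)`.
[cite: Shimura1971, §3.4 Prop. 3.38] -/
theorem restrictLevel_restrictLevel_degeneracyMap0_one (hqM : ¬ q ∣ M) (f : CuspForm (Gamma0 M) k) :
    restrictLevel (Gamma0 (M * q)) (Gamma0 M) k (restrictLevel (Gamma0 (M * q ^ 2)) (Gamma0 (M * q)) k
        (degeneracyMap0 M (M * q ^ 2) 1 k f)) = ((q : ℂ) * ((q : ℂ) + 1)) • f := by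
  rw [degeneracyMap0_one_eq_toLevel0, restrictLevel_toLevel0 k q (M * q) (M * q ^ 2) (by ring) (dvd_mul_left q M),
    map_smul, restrictLevel_toLevel0_of_not_dvd k hqM, smul_smul]

/-- **`Tr^{Mq}_M Tr^{Mq²}_{Mq} B_q = q T_q`** on `S_k(Γ₀(M))` (`q ∤ M` prime).
[cite: Shimura1971, §3.4 Prop. 3.38] -/
theorem restrictLevel_restrictLevel_degeneracyMap0_self (hqM : ¬ q ∣ M) (f : CuspForm (Gamma0 M) k) :
    restrictLevel (Gamma0 (M * q)) (Gamma0 M) k (restrictLevel (Gamma0 (M * q ^ 2)) (Gamma0 (M * q)) k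
        (degeneracyMap0 M (M * q ^ 2) q k f)) = (q : ℂ) • heckeT (Gamma0 M) k q f := by
  rw [degeneracyMap0_eq_toLevel0_degeneracyMap0,
    restrictLevel_toLevel0 k q (M * q) (M * q ^ 2) (by ring) (dvd_mul_left q M), map_smul,
    restrictLevel_degeneracyMap0_eq_heckeT k hqM]

/-- **`Tr^{Mq}_M Tr^{Mq²}_{Mq} B_{q²} = T_q² − q^{k−2}(q+1)`** on `S_k(Γ₀(M))` (`q ∤ M` prime): the double coset
`Γ₀(M) diag(q²,1) Γ₀(M) = T_q² − (q+1)[Γ₀(M) q·1 Γ₀(M)]`. [cite: Shimura1971, §3.4 Prop. 3.38] -/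
theorem restrictLevel_restrictLevel_degeneracyMap0_sq (hqM : ¬ q ∣ M) (f : CuspForm (Gamma0 M) k) :
    restrictLevel (Gamma0 (M * q)) (Gamma0 M) k (restrictLevel (Gamma0 (M * q ^ 2)) (Gamma0 (M * q)) k
        (degeneracyMap0 M (M * q ^ 2) (q ^ 2) k f)) =
      heckeT (Gamma0 M) k q (heckeT (Gamma0 M) k q f) - ((q : ℂ) ^ (k - 2) * ((q : ℂ) + 1)) • f := by
  rw [degeneracyMap0_sq_eq, restrictLevel_degeneracyMap0_degeneracyMap0 k hqM, map_sub, map_smul,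
    restrictLevel_degeneracyMap0_eq_heckeT k hqM, restrictLevel_toLevel0_of_not_dvd k hqM, smul_smul]

end Summit.BirchSwinnertonDyer.BirchSwinnertonDyer.Theorems.LTwistTransfer

end
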